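import Summits.BirchSwinnertonDyer.BirchSwinnertonDyer.Theorems.EdixhovenFibreFiveSevenStarredOptimalManinUnitFiveSevenAssembly
import Summits.BirchSwinnertonDyer.BirchSwinnertonDyer.Theorems.EdixhovenFibreFiveSevenStarredOptimalManinUnitFiveSeven
import HarnessLib

/-!
# Route `EdixhovenFibreFiveSeven`, crux K★ `StarredOptimalManinUnitFiveSeven` (stmt-BirchSwinnertonDyer-22226): Manin's `p`-part
# at the `X₀(N)`-optimal curve of STARRED additive type at `p ∈ {5, 7}` — GRANTED Kato's SL₂(ℤ)-type zeta values in a Néron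
# coordinate (P1) and three standard `p`-adic Hodge facts (CONDITIONAL closer; the F″ programme assembled)

Cell `pub/bsd-wall`, seat `bsd-line-edix-p4` g3 (line `kato-lever`). CONDITIONAL RESULT: the route declaration follows from
FOUR cite-only Literature facts displayed as hypotheses — P1 `Kato2004.exists_member_sl2ZetaElement_neron_values` (Kato 2004
(8.1.3) + Thm. 9.7 + Thm. 6.6 (1), case `ξ ∈ SL₂(ℤ)`, + Thm. 13.6 at Kato's member, Néron-pinned; XL, no `_holds`),
(S5b-tower) `PAdicHodge.exists_smul_range_expStarCoord_tower_iff_trace_log` (Kato LNM 1553 II Thm. 1.4.1 + Bloch–Kato Prop. 3.8),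
`PAdicHodge.cupLogInjective_and_hasDualExp_of_isDeRham` (Kato LNM 1553 II Prop. 1.2.3), `PAdicHodge.isDeRham_restrictedRationalTateRep`
(Faltings / Tsuji: `V_pE` is de Rham) — by composing the landed conditional closer `starredOptimalManinUnitFiveSeven_of_kato : F″ → K★`
(p581141, seat edix-p1) with the F″ programme's final assembly `KatoAssemblySocket.kato_neron_five_le_of_sl2NeronValues`
(F″ ⟸ the four facts; seats edix-p1…p5, manin-p1). The item stays OPEN until P1 has a `_holds`; nothing open is asserted; BSD is
not proved by any of this.
-/

set_option autoImplicit false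
-- the Theorems namespace of a single-conjunct summit repeats the summit name by design (D-0017)
set_option linter.dupNamespace false

noncomputable section

namespace Summit.BirchSwinnertonDyer.BirchSwinnertonDyer.Theorems

/-- **K★ ⟸ P1 + (S5b-tower) + Kato II 1.2.3 + de Rham** (conditional closer of stmt-BirchSwinnertonDyer-22226): Manin's
`p`-part at the lattice-optimal datum of an `X₀(N)`-optimal curve of starred additive type at `p ∈ {5, 7}` with `E[p]`
irreducible, granted Kato's SL₂(ℤ)-type zeta values in a Néron coordinate and the three `p`-adic Hodge facts —
`starredOptimalManinUnitFiveSeven_of_kato` ∘ `KatoAssemblySocket.kato_neron_five_le_of_sl2NeronValues`.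
[cite: Kato2004Asterisque, (8.1.3) (p. 180), Thm. 9.7 (p. 189), Thm. 6.6 (1) (p. 163), Thm. 13.6 (p. 227)]
[cite: Kato1993LNM1553, Ch. II §1.2.4 and Thm. 1.4.1 (3)-(4)] [cite: BlochKato1990, Prop. 3.8 and Example 3.11]
[cite: KimNakamura2020, Cor. 2.4] [cite: EdixhovenManin1991, Thm. 3 and §4] -/
theorem starredOptimalManinUnitFiveSeven_of_sl2NeronValues
    (hT₂ : Literature.NumberTheory.PAdicHodge.exists_smul_range_expStarCoord_tower_iff_trace_log)
    (hP : Literature.NumberTheory.PAdicHodge.cupLogInjective_and_hasDualExp_of_isDeRham)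
    (hDR : Literature.NumberTheory.PAdicHodge.isDeRham_restrictedRationalTateRep)
    (hP1 : Literature.NumberTheory.EllipticCurves.Kato2004.exists_member_sl2ZetaElement_neron_values) :
    Summit.BirchSwinnertonDyer.BirchSwinnertonDyer.Theses.EdixhovenFibreFiveSeven.StarredOptimalManinUnitFiveSeven :=
  starredOptimalManinUnitFiveSeven_of_kato (KatoAssemblySocket.kato_neron_five_le_of_sl2NeronValues hT₂ hP hDR hP1)

end Summit.BirchSwinnertonDyer.BirchSwinnertonDyer.Theorems

end
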